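import Literature.AlgebraicGeometry.HodgeTheory.KodairaSerreSections
import Literature.AlgebraicGeometry.HodgeTheory.SerreTheoremALineBundlesProofs
import Literature.AlgebraicGeometry.HodgeTheory.TopDegreeClasses
import Literature.Geometry.Kaehler.HolomorphicLineBundleCechH0
import Literature.Geometry.Kaehler.FlagAdaptedCovers
import Literature.Geometry.Kaehler.HolomorphicLineBundleCechZeroDim
import Literature.Geometry.Kaehler.HolomorphicLineBundleCechRefine
import HarnessLib

/-!
# Kodaira–Serre sections in all dimensions: Serre's dimension count along a transverse flag

Proof file for `Literature.AlgebraicGeometry.HodgeTheory.kodairaSerre_exists_globalSection_algebraicTwist`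
(C. Voisin, *Hodge Theory and Complex Algebraic Geometry I* (2002), proof of Cor. 11.34: every
holomorphic line bundle `L` on a projective manifold has, after an algebraic twist, a holomorphic
section which does not vanish identically), in ALL dimensions `n`, by J.-P. Serre's dimension count
(*Géométrie algébrique et géométrie analytique* (1956), n° 16 Lemme 8; *Faisceaux algébriques
cohérents* (1955), n° 81) read on GENUINE complex submanifolds:

* a transverse flag `u₀, …, u_{n-1}` of algebraic sections of `𝒪_X(H)` (`exists_transverse_flag`,
  packaged as `FlagSections`) gives regular equations of every length `k ≤ n` (`RegularFlag.eqns`),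
  whose zero loci `Z_k = {u₀ = ⋯ = u_{k-1} = 0}` are compact complex manifolds of dimension `n - k`
  (`RegularEquations.atlas`, file `RegularZeroLocus`), `Z_0 = M`, `Z_n` finite non-empty;
* ONE framed cover `𝔙` of `M` by open sets adapted to the flag (`RegularFlag.exists_adapted`,
  `AdaptedCover`), a framed cover of every twist `L_m = L ⊗ 𝒪_X(mH)^an` (`twistBundle`) and, by
  preimage, of every `L_m|Z_k` (`FramedCover.comap`); the numbers
  `H0 k m = dim Ȟ⁰(𝔙 ∩ Z_k, L_m)`, `H1 k m = dim Ȟ¹(𝔙 ∩ Z_k, L_m)` are finite (Cartan–Serre: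
  `FramedCover.finite_cohomology_zero`, `FramedCover.finite_cohomology_one`);
* for `k' + 1 ≤ n` the restriction step `0 → C•(L_m|Z_{k'}) →^{u_{k'}} C•(L_{m+1}|Z_{k'}) → C•(L_{m+1}|Z_{k'+1})`
  (`RestrictionStep`, file `HolomorphicLineBundleCechRestrictionSeq`; onto in degree `0` by
  adaptedness, `RestrictionStep.surjective_res_zero_of_isAdapted`) yields the six-term inequality
  `H0 k' m + H0 (k'+1) (m+1) + H1 k' (m+1) ≤ H0 k' (m+1) + H1 k' m + H1 (k'+1) (m+1)`
  (`AdaptedCover.six_term`);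
* at the bottom `Z_n` is zero-dimensional: `H1 n m = 0 < H0 n m`
  (file `HolomorphicLineBundleCechZeroDim`, `AdaptedCover.base_lt`);
* the tower count `exists_pos_h0_of_euler_inequalities` gives `H0 0 m > 0` for some `m`, i.e. a
  holomorphic section of `L_m|Z_0` not vanishing identically, pushed down to `M = Z_0`
  (`AdaptedCover.exists_globalSection`), with the algebraic section `1` of `mH`.

Dimension `0` is the same count with the empty flag (`H` the unit divisor). Everything is proved; the
surface case `serre_theoremA_lineCocycle_surface_holds` (file `SerreTheoremALineBundlesProofs`, by
cokernel complexes) is an independent proof for `n = 2` whose elementary lemmas are reused here.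

## References

* C. Voisin, *Hodge Theory and Complex Algebraic Geometry I* (2002), Cor. 11.34 (proof), Thm. 7.11.
  [VoisinHodgeI2002]
* J.-P. Serre, *Géométrie algébrique et géométrie analytique*, Ann. Inst. Fourier 6 (1956), n° 16
  Lemme 8. [SerreGAGA1956]
* J.-P. Serre, *Faisceaux algébriques cohérents*, Ann. of Math. 61 (1955), n° 81. [SerreFAC1955]
-/

noncomputable section

open scoped Manifold ContDiff Topology
open CategoryTheory AlgebraicGeometry TopologicalSpace Set Function Module
open Literature.AlgebraicGeometry.Motives
open Literature.AlgebraicGeometry.Motives.RatFn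
open Literature.AlgebraicGeometry.Motives.AlgPoints
open Literature.NumberTheory.Transcendental
open Literature.Geometry.Kaehler
open Literature.Geometry.Kaehler.HolomorphicLineBundle
open Literature.Algebra.Homology

namespace Literature.AlgebraicGeometry.HodgeTheory

namespace KodairaSerreFlag

/-! ### The base of the tower: zero-dimensional levels -/

section Base

variable {E : Type*} [NormedAddCommGroup E] [NormedSpace ℂ E] [FiniteDimensional ℂ E]
  {M : Type*} [TopologicalSpace M] [ChartedSpace E M] [IsManifold 𝓘(ℂ, E) ω M] [T2Space M]
  [CompactSpace M] {α : Type*} {k d : ℕ}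

/-- **`h¹ < h⁰` on a non-empty zero-dimensional regular zero locus**, for every covering framed
cover of every cocycle line bundle on it (the base of Serre's tower; stated for a dimension
parameter `d = 0` so that it applies to `d = n - n`). [cite: SerreGAGA1956, n° 16 Lemme 8] -/
theorem finrank_cohomology_one_lt_of_dim_eq_zero (hd0 : d = 0) (Q : RegularEquations E M α k)
    (hd : finrank ℂ E = k + d) (hne : Q.locus.Nonempty) {ι' κ : Type*}
    {L' : HolomorphicLineBundle ι' (Fin d → ℂ) (Q.atlas hd).Carrier} (W : L'.FramedCover κ)
    (hcov : ∀ y, ∃ c, y ∈ W.U c) :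
    finrank ℂ (W.cohomology 1) < finrank ℂ (W.cohomology 0) := by
  subst hd0
  haveI := Q.compactSpace_carrier hd
  haveI : Nonempty (Q.atlas hd).Carrier := ⟨(Q.atlas hd).ofSubtype ⟨hne.some, hne.some_mem⟩⟩
  exact FramedCover.finrank_cohomology_one_lt_zero_of_finZero L' W hcov

end Base

variable {X : SchemeOver ℂ} [IsIntegral X.left] {n : ℕ}
  {E : Type} [NormedAddCommGroup E] [NormedSpace ℂ E] [FiniteDimensional ℂ E]
  {M : Type} [TopologicalSpace M] [ChartedSpace E M]
  {φ : M → ComplexPoints X}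

/-! ### Transverse flags of algebraic sections -/

variable (E) in
/-- **A transverse flag of algebraic sections of `𝒪_X(H)` read on the analytification** — the
output of `exists_transverse_flag`: sections `s₀, …, s_{n-1}` whose frame coordinates
`u_{j,a} = (f_a s_j) ∘ φ` have jointly onto differentials at the common zeroes of `u_{0,a}, …, u_{j-1,a}`
for every `j ≤ n`, with non-empty common zero set of all of them. [cite: SerreGAGA1956, n° 16 Lemme 8] -/
structure FlagSections (φ : M → ComplexPoints X) (H : CartierDivisor X.left) (n : ℕ) : Type where
  /-- the sections -/
  s : Fin n → X.left.functionField
  /-- they are sections of `𝒪_X(H)` -/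
  isSection : ∀ j, H.IsSection (s j)
  /-- transversality along the flag -/
  surjective_pi : ∀ (a : H.ι) (m : M) (j : ℕ) (hj : j ≤ n), (φ m).pt ∈ H.U a →
    (∀ i : Fin j, H.sectionCoord φ (isSection (Fin.castLE hj i)) a m = 0) →
      Surjective (ContinuousLinearMap.pi fun i : Fin j ↦
        mfderiv 𝓘(ℂ, E) 𝓘(ℂ, ℂ) (H.sectionCoord φ (isSection (Fin.castLE hj i)) a) m)
  /-- the common zero set is non-empty -/
  nonempty : {m : M | ∃ a : H.ι, (φ m).pt ∈ H.U a ∧ ∀ j, H.sectionCoord φ (isSection j) a m = 0}.Nonempty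

namespace FlagSections

variable {H : CartierDivisor X.left} (F : FlagSections E φ H n) (hφ : IsAnalytification E X n φ)

/-- **The regular flag of the frame coordinates** `u_{j,a}` on the opens `φ⁻¹(U_a(ℂ))`.
[cite: SerreGAGA1956, n° 16 Lemme 8] -/
def flag : RegularFlag E M H.ι n where
  O a := φ ⁻¹' {P | P.pt ∈ H.U a}
  isOpen_O a := hφ.isOpen_preimage (H.U a)
  cover m := H.covers (φ m).pt
  u j a := H.sectionCoord φ (F.isSection j) a
  mdifferentiableOn_u j a := mdifferentiableOn_sectionCoord hφ (F.isSection j) a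
  zero_iff j _ _ _ ha hb := SerreTheoremASurface.sectionCoord_eq_zero_iff H (F.isSection j) ha hb
  surjective_pi k hk a m ha h0 := F.surjective_pi a m k hk ha h0

/-- The opens of the flag (definitional). [folklore] -/
@[simp] theorem flag_O (a : H.ι) : (F.flag hφ).O a = φ ⁻¹' {P | P.pt ∈ H.U a} := rfl

/-- The functions of the flag (definitional). [folklore] -/
@[simp] theorem flag_u (j : Fin n) (a : H.ι) : (F.flag hφ).u j a = H.sectionCoord φ (F.isSection j) a := rfl

omit [IsIntegral X.left] in
include hφ in
/-- The dimension bookkeeping of the level with `k` equations. [folklore] -/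
theorem hdim {k : ℕ} (hk : k ≤ n) : finrank ℂ E = k + (n - k) := by
  rw [hφ.finrank_eq]; omega

/-- The deepest level is non-empty. [cite: SerreGAGA1956, n° 16 Lemme 8] -/
theorem locus_top_nonempty : ((F.flag hφ).eqns n le_rfl).locus.Nonempty := by
  obtain ⟨m, a, ha, hz⟩ := F.nonempty
  exact ⟨m, a, ha, funext fun i ↦ hz (Fin.castLE le_rfl i)⟩

variable [IsManifold 𝓘(ℂ, E) ω M]

/-- **The level `Z_k`** as a compact complex manifold of dimension `n - k`. [cite: SerreGAGA1956, n° 16 Lemme 8] -/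
abbrev Z (k : ℕ) (hk : k ≤ n) : AmbientHolAtlas E ((F.flag hφ).eqns k hk).locus (n - k) :=
  ((F.flag hφ).eqns k hk).atlas (hdim hφ hk)

/-! ### Framed covers adapted to the flag -/

/-- **A framed cover of `M` adapted to the flag**, indexed by the points of `M`: open sets
`V_c ∋ c` inside a trivialising set of `L_0 = L ⊗ 𝒪_X(0·H)^an` (hence of every `L_m`) and adapted
to the flag (`RegularFlag.IsAdapted`). [cite: SerreFAC1955, n° 81] -/
structure AdaptedCover {ι : Type} (L : HolomorphicLineBundle ι E M) where
  /-- the members -/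
  V : M → Set M
  /-- the frames -/
  fr : M → ι × H.ι
  /-- the members are open -/
  isOpen : ∀ c, IsOpen (V c)
  /-- the member at `c` contains `c` -/
  mem : ∀ c, c ∈ V c
  /-- the members are small for the frames -/
  subset : ∀ c, V c ⊆ (twistBundle hφ H L 0).baseSet (fr c)
  /-- the members are adapted to the flag -/
  isAdapted : ∀ c, (F.flag hφ).IsAdapted (V c)

/-- **Adapted framed covers exist** (`RegularFlag.exists_adapted` inside the trivialising sets of `L`).
[cite: SerreFAC1955, n° 81] -/
theorem nonempty_adaptedCover {ι : Type} (L : HolomorphicLineBundle ι E M) :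
    Nonempty (F.AdaptedCover hφ L) := by
  choose i hi using fun c : M ↦ L.exists_mem_baseSet c
  obtain ⟨V, a, hVo, hVc, hVW, hVO, hVad⟩ := (F.flag hφ).exists_adapted hφ.finrank_eq
    (W := fun c ↦ L.baseSet (i c)) (fun c ↦ L.isOpen_baseSet _) hi
  exact ⟨⟨V, fun c ↦ (i c, a c), hVo, hVc, fun c x hx ↦ ⟨hVW c hx, hVO c hx⟩, hVad⟩⟩

namespace AdaptedCover

variable {F hφ} {ι : Type} {L : HolomorphicLineBundle ι E M} (C : F.AdaptedCover hφ L)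

/-- **`𝔙` as a framed cover of `L_m`** (the trivialising sets do not depend on `m`). [cite: SerreGAGA1956, n° 16 Lemme 8] -/
def baseCover (m : ℕ) : (twistBundle hφ H L m).FramedCover M where
  U := C.V
  isOpen := C.isOpen
  frame := C.fr
  subset c := C.subset c

/-- `𝔙` covers `M`. [folklore] -/
theorem baseCover_covers (m : ℕ) (x : M) : ∃ c, x ∈ (C.baseCover m).U c := ⟨x, C.mem x⟩

/-- **`𝔙 ∩ Z_k` as a framed cover of `L_m|Z_k`.** [cite: SerreGAGA1956, n° 16 Lemme 8] -/
def levelCover (k : ℕ) (hk : k ≤ n) (m : ℕ) :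
    ((twistBundle hφ H L m).pullback (F.Z hφ k hk).val (F.Z hφ k hk).mdifferentiable_val).FramedCover M :=
  (C.baseCover m).comap (F.Z hφ k hk).val (F.Z hφ k hk).mdifferentiable_val

/-- `𝔙 ∩ Z_k` covers `Z_k`. [folklore] -/
theorem levelCover_covers (k : ℕ) (hk : k ≤ n) (m : ℕ) (y : (F.Z hφ k hk).Carrier) :
    ∃ c, y ∈ (C.levelCover k hk m).U c :=
  ⟨(F.Z hφ k hk).val y, C.mem _⟩

section Finite

variable [T2Space M] [CompactSpace M]

/-- `Ȟ⁰(𝔙 ∩ Z_k, L_m)` is finite-dimensional (Cartan–Serre). [cite: CartanSerre1953] -/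
theorem finite_cohomology_zero (k : ℕ) (hk : k ≤ n) (m : ℕ) :
    FiniteDimensional ℂ ((C.levelCover k hk m).cohomology 0) := by
  haveI := ((F.flag hφ).eqns k hk).compactSpace_carrier (hdim hφ hk)
  exact (C.levelCover k hk m).finite_cohomology_zero (C.levelCover_covers k hk m)

/-- `Ȟ¹(𝔙 ∩ Z_k, L_m)` is finite-dimensional (Cartan–Serre). [cite: CartanSerre1953] -/
theorem finite_cohomology_one (k : ℕ) (hk : k ≤ n) (m : ℕ) :
    FiniteDimensional ℂ ((C.levelCover k hk m).cohomology 1) := by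
  haveI := ((F.flag hφ).eqns k hk).compactSpace_carrier (hdim hφ hk)
  exact (C.levelCover k hk m).finite_cohomology_one (C.levelCover_covers k hk m)

end Finite

/-- **`H0 k m = dim Ȟ⁰(𝔙 ∩ Z_k, L_m)`** (`0` beyond `k = n`). [cite: SerreGAGA1956, n° 16 Lemme 8] -/
def H0 (k m : ℕ) : ℕ :=
  if hk : k ≤ n then finrank ℂ ((C.levelCover k hk m).cohomology 0) else 0

/-- **`H1 k m = dim Ȟ¹(𝔙 ∩ Z_k, L_m)`** (`0` beyond `k = n`). [cite: SerreGAGA1956, n° 16 Lemme 8] -/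
def H1 (k m : ℕ) : ℕ :=
  if hk : k ≤ n then finrank ℂ ((C.levelCover k hk m).cohomology 1) else 0

/-- `H0` within range. [folklore] -/
theorem H0_eq {k : ℕ} (hk : k ≤ n) (m : ℕ) :
    C.H0 k m = finrank ℂ ((C.levelCover k hk m).cohomology 0) :=
  dif_pos hk

/-- `H1` within range. [folklore] -/
theorem H1_eq {k : ℕ} (hk : k ≤ n) (m : ℕ) :
    C.H1 k m = finrank ℂ ((C.levelCover k hk m).cohomology 1) :=
  dif_pos hk

/-! ### The restriction steps -/

/-- **The restriction step `Z_{k'+1} ⊆ Z_{k'}` at twist `m`**: multiplication by `u_{k'}`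
(`homSectionOfIsSection` of `s_{k'}`) from `L_m` to `L_{m+1}` on the cover `𝔙`, whose coordinate in
the frame of `V_c` is the last equation of `Z_{k'+1}` in the chart of `V_c`. [cite: SerreGAGA1956, n° 16 Lemme 8] -/
def step (k' : ℕ) (hk : k' + 1 ≤ n) (m : ℕ) :
    RestrictionStep ((F.flag hφ).eqns k' ((Nat.le_succ k').trans hk)) ((F.flag hφ).eqns (k' + 1) hk)
      (ι × H.ι) M where
  isPrefix := (F.flag hφ).isPrefix (Nat.le_succ k') hk
  L₀ := twistBundle hφ H L m
  L₁ := twistBundle hφ H L (m + 1)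
  t := homSectionOfIsSection hφ H L (F.isSection ⟨k', hk⟩) m
  cover := C.baseCover m
  subset_L₁ c := C.subset c
  chartIdx c := (C.fr c).2
  subset_O c _ hx := (C.subset c hx).2
  coord_eq _ _ _ := rfl

/-- The complex `A` of the step is `C•(𝔙 ∩ Z_{k'}, L_m)` (definitional). [folklore] -/
theorem step_coverA (k' : ℕ) (hk : k' + 1 ≤ n) (m : ℕ) :
    (C.step k' hk m).coverA (hdim hφ ((Nat.le_succ k').trans hk)) =
      C.levelCover k' ((Nat.le_succ k').trans hk) m :=
  rfl

/-- The complex `B` of the step is `C•(𝔙 ∩ Z_{k'}, L_{m+1})` (definitional). [folklore] -/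
theorem step_coverB (k' : ℕ) (hk : k' + 1 ≤ n) (m : ℕ) :
    (C.step k' hk m).coverB (hdim hφ ((Nat.le_succ k').trans hk)) =
      C.levelCover k' ((Nat.le_succ k').trans hk) (m + 1) :=
  rfl

/-- The complex `C` of the step is `C•(𝔙 ∩ Z_{k'+1}, L_{m+1})` (definitional). [folklore] -/
theorem step_coverC (k' : ℕ) (hk : k' + 1 ≤ n) (m : ℕ) :
    (C.step k' hk m).coverC (hdim hφ hk) = C.levelCover (k' + 1) hk (m + 1) :=
  rfl

/-- **The six-term inequality of a restriction step**:
`H0 k' m + H0 (k'+1) (m+1) + H1 k' (m+1) ≤ H0 k' (m+1) + H1 k' m + H1 (k'+1) (m+1)`.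
[cite: SerreGAGA1956, n° 16 Lemme 8 (dimension count)] -/
theorem six_term [T2Space M] [CompactSpace M] (k' : ℕ) (hk : k' + 1 ≤ n) (m : ℕ) :
    C.H0 k' m + C.H0 (k' + 1) (m + 1) + C.H1 k' (m + 1) ≤
      C.H0 k' (m + 1) + C.H1 k' m + C.H1 (k' + 1) (m + 1) := by
  -- finiteness of the six spaces, on the covers of the step themselves
  haveI := ((F.flag hφ).eqns k' ((Nat.le_succ k').trans hk)).compactSpace_carrier
    (hdim hφ ((Nat.le_succ k').trans hk))
  haveI := ((F.flag hφ).eqns (k' + 1) hk).compactSpace_carrier (hdim hφ hk)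
  have hcovA := (C.step k' hk m).coverA_covers (hdim hφ ((Nat.le_succ k').trans hk)) (C.baseCover_covers m)
  have hcovC := (C.step k' hk m).coverC_covers (hdim hφ hk) (C.baseCover_covers m)
  haveI : FiniteDimensional ℂ
      (((C.step k' hk m).coverA (hdim hφ ((Nat.le_succ k').trans hk))).cohomology 1) :=
    ((C.step k' hk m).coverA (hdim hφ ((Nat.le_succ k').trans hk))).finite_cohomology_one hcovA
  haveI : FiniteDimensional ℂ
      (((C.step k' hk m).coverB (hdim hφ ((Nat.le_succ k').trans hk))).cohomology 0) :=
    ((C.step k' hk m).coverB (hdim hφ ((Nat.le_succ k').trans hk))).finite_cohomology_zero hcovA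
  haveI : FiniteDimensional ℂ
      (((C.step k' hk m).coverB (hdim hφ ((Nat.le_succ k').trans hk))).cohomology 1) :=
    ((C.step k' hk m).coverB (hdim hφ ((Nat.le_succ k').trans hk))).finite_cohomology_one hcovA
  haveI : FiniteDimensional ℂ (((C.step k' hk m).coverC (hdim hφ hk)).cohomology 0) :=
    ((C.step k' hk m).coverC (hdim hφ hk)).finite_cohomology_zero hcovC
  haveI : FiniteDimensional ℂ (((C.step k' hk m).coverC (hdim hφ hk)).cohomology 1) :=
    ((C.step k' hk m).coverC (hdim hφ hk)).finite_cohomology_one hcovC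
  have h := (C.step k' hk m).finrank_six_term_le (hdim hφ hk) (hdim hφ ((Nat.le_succ k').trans hk))
    ((C.step k' hk m).surjective_res_zero_of_isAdapted (hdim hφ hk)
      (hdim hφ ((Nat.le_succ k').trans hk)) fun c ↦ C.isAdapted c)
  rw [C.H0_eq ((Nat.le_succ k').trans hk), C.H0_eq hk, C.H1_eq ((Nat.le_succ k').trans hk),
    C.H0_eq ((Nat.le_succ k').trans hk), C.H1_eq ((Nat.le_succ k').trans hk), C.H1_eq hk,
    ← C.step_coverA k' hk m, ← C.step_coverB k' hk m, ← C.step_coverC k' hk m]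
  exact h

/-- **The base of the tower**: `H1 n m < H0 n m` (`Z_n` is a non-empty finite set).
[cite: SerreGAGA1956, n° 16 Lemme 8] -/
theorem base_lt [T2Space M] [CompactSpace M] (m : ℕ) : C.H1 n m < C.H0 n m := by
  rw [C.H0_eq le_rfl, C.H1_eq le_rfl]
  exact finrank_cohomology_one_lt_of_dim_eq_zero (Nat.sub_self n) ((F.flag hφ).eqns n le_rfl)
    (hdim hφ le_rfl) (F.locus_top_nonempty hφ) (C.levelCover n le_rfl m)
    (C.levelCover_covers n le_rfl m)

/-- **Serre's count**: `H0 0 m > 0` for some `m`. [cite: SerreGAGA1956, n° 16 Lemme 8 (dimension count)] -/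
theorem exists_pos_H0_zero [T2Space M] [CompactSpace M] : ∃ m, 0 < C.H0 0 m := by
  have h := exists_pos_h0_of_euler_inequalities n (fun j m ↦ C.H0 (n - j) m) (fun j m ↦ C.H1 (n - j) m)
    (fun j hj m ↦ by
      have e1 : n - j = n - (j + 1) + 1 := by omega
      simp only [e1]
      exact C.six_term (n - (j + 1)) (by omega) m)
    (fun m ↦ by simpa only [Nat.sub_zero] using C.base_lt m)
  simpa only [Nat.sub_self] using h

include C in
/-- **A holomorphic section of some `L_m = L ⊗ 𝒪_X(mH)^an` which does not vanish identically**: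
`Z_0 = M`, and a non-zero section of `L_m|Z_0` (`H0 0 m > 0`) is pushed down along the inverse of
the identification `Z_0 → M`. [cite: VoisinHodgeI2002, Cor. 11.34 (proof)] [cite: SerreGAGA1956, n° 16 Lemme 8] -/
theorem exists_globalSection [T2Space M] [CompactSpace M] :
    ∃ (m : ℕ) (σ : (twistBundle hφ H L m).GlobalSection), σ.zeroSet ≠ univ := by
  obtain ⟨m, hm⟩ := C.exists_pos_H0_zero
  have h0 : 0 ≤ n := Nat.zero_le n
  rw [C.H0_eq h0] at hm
  haveI := ((F.flag hφ).eqns 0 h0).compactSpace_carrier (hdim hφ h0)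
  rw [(C.levelCover 0 h0 m).finrank_cohomology_zero (C.levelCover_covers 0 h0 m)] at hm
  obtain ⟨σ', hσ'⟩ := HolomorphicLineBundle.exists_zeroSet_ne_univ_of_h0_pos hm
  -- the inverse `M → Z_0` of the inclusion
  have hmem : ∀ x : M, x ∈ ((F.flag hφ).eqns 0 h0).locus := (F.flag hφ).mem_locus_zero
  let inv : M → (F.Z hφ 0 h0).Carrier := fun x ↦ (F.Z hφ 0 h0).ofSubtype ⟨x, hmem x⟩
  have hinv : MDifferentiable 𝓘(ℂ, E) 𝓘(ℂ, Fin (n - 0) → ℂ) inv := fun x ↦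
    (F.Z hφ 0 h0).mdifferentiableAt_of_val_comp mdifferentiableAt_id
  have hiv : ∀ y, inv ((F.Z hφ 0 h0).val y) = y := fun y ↦ (F.Z hφ 0 h0).val_injective rfl
  let σ : (twistBundle hφ H L m).GlobalSection :=
    { coord := fun p x ↦ σ'.coord p (inv x)
      mdifferentiableOn_coord := fun p ↦
        (σ'.mdifferentiableOn_coord p).comp hinv.mdifferentiableOn fun x hx ↦ hx
      coord_eq_mul := fun p q x hx ↦ σ'.coord_eq_mul p q (inv x) hx }
  refine ⟨m, σ, fun huniv ↦ hσ' (Set.eq_univ_of_forall fun y ↦ ?_)⟩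
  have hy : (F.Z hφ 0 h0).val y ∈ σ.zeroSet := by rw [huniv]; exact mem_univ _
  obtain ⟨p, hp, hzero⟩ := hy
  refine ⟨p, hp, ?_⟩
  change σ'.coord p (inv ((F.Z hφ 0 h0).val y)) = 0 at hzero
  rwa [hiv] at hzero

end AdaptedCover

include F in
/-- **Serre's dimension count along a transverse flag** (GAGA n° 16 Lemme 8 on the genuine
submanifolds `Z_k`): for every cocycle line bundle `L` some twist `L ⊗ 𝒪_X(mH)^an` has a holomorphic
section which does not vanish identically. [cite: SerreGAGA1956, n° 16 Lemme 8] -/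
theorem exists_globalSection [T2Space M] [CompactSpace M] {ι : Type} (L : HolomorphicLineBundle ι E M) :
    ∃ (m : ℕ) (σ : (twistBundle hφ H L m).GlobalSection), σ.zeroSet ≠ univ := by
  obtain ⟨C⟩ := F.nonempty_adaptedCover hφ L
  exact C.exists_globalSection

end FlagSections

/-! ### Dimension zero: the empty flag -/

/-- The empty flag in dimension `0` (no sections, the unit divisor; the common zero set of no
functions is all of the non-empty `M`). [folklore] -/
def flagSectionsZero [Nonempty M] (φ : M → ComplexPoints X) :
    FlagSections E φ (CartierDivisor.principal (1 : X.left.functionField) one_ne_zero) 0 where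
  s j := j.elim0
  isSection j := j.elim0
  surjective_pi a m j hj _ _ := by
    obtain rfl : j = 0 := Nat.le_zero.1 hj
    intro v
    exact ⟨0, funext fun i ↦ i.elim0⟩
  nonempty := ⟨Classical.arbitrary M, PUnit.unit, trivial, fun j ↦ j.elim0⟩

/-- `1` is a section of the unit divisor. [folklore] -/
theorem isSection_one_principal_one :
    (CartierDivisor.principal (1 : X.left.functionField) one_ne_zero).IsSection 1 := fun _ x _ ↦ by
  change IsRegularAt x ((1 : X.left.functionField) * 1)
  rw [mul_one]
  exact isRegularAt_one

end KodairaSerreFlag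

/-! ### Assembly -/

open KodairaSerreFlag in
/-- **Kodaira–Serre: a non-vanishing holomorphic section after an algebraic twist, in all
dimensions** (Voisin I, proof of Cor. 11.34; here by Serre's dimension count, GAGA n° 16 Lemme 8,
along a transverse flag of hyperplane sections): for `X` smooth projective over `ℂ` and a cocycle
line bundle `L` on `X^an` there are a Cartier divisor `D = mH`, the non-zero algebraic section `1` of
`𝒪_X(D)`, and a holomorphic section of `L ⊗ 𝒪_X(D)^an` that does not vanish identically.
[cite: VoisinHodgeI2002, Cor. 11.34 (proof) and Thm. 7.11] [cite: SerreGAGA1956, n° 16 Lemme 8] -/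
theorem kodairaSerre_exists_globalSection_algebraicTwist_holds :
    kodairaSerre_exists_globalSection_algebraicTwist := by
  intro n X hX
  haveI : IsIntegral X.left := IsSmoothProjective.isIntegral_holds hX
  intro A ι L
  haveI : CompactSpace A.carrier := compactSpace_carrier_of_isSmoothProjective' A hX
  have hφ : IsAnalytification A.model X n A.toComplexPoints := A.isAnalytification
  obtain hn | hn := Nat.eq_zero_or_pos n
  · -- dimension `0`: the empty flag
    subst hn
    haveI : Nonempty A.carrier :=
      (connectedSpace_complexPoints hX).toNonempty.map A.isAnalytification.homeomorph.symm
    obtain ⟨m, σ, hσ⟩ := (flagSectionsZero A.toComplexPoints).exists_globalSection hφ L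
    exact ⟨m • CartierDivisor.principal (1 : X.left.functionField) one_ne_zero, 1,
      isSection_one_smul isSection_one_principal_one m, one_ne_zero, σ, hσ⟩
  · -- positive dimension: a transverse flag of hyperplane sections
    obtain ⟨H, s, hs, hs0, hflag, -, hZne, -⟩ := exists_transverse_flag hX hn hφ
    have h1 : H.IsSection 1 := by rw [← hs0]; exact hs ⟨0, hn⟩
    let F : FlagSections A.model A.toComplexPoints H n := ⟨s, hs, hflag, hZne⟩
    obtain ⟨m, σ, hσ⟩ := F.exists_globalSection hφ L
    exact ⟨m • H, 1, isSection_one_smul h1 m, one_ne_zero, σ, hσ⟩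

end Literature.AlgebraicGeometry.HodgeTheory
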